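import Literature.Barriers.CriticalPhenomena.LaceExpansionPcLimit
import HarnessLib

/-!
# The left limit of the lace-expansion coefficients at `p_c`, proved:
# `Hara2008_piLeftLimit` from `Hara2008_prop12Subcrit` (compactness and uniqueness at `p_c`)

Barrier catalogue `Literature/Barriers/CriticalPhenomena/` (D-0021), companion of
`LaceExpansionPcSubcrit.lean` (the named facts `Hara2008_prop12Subcrit`, `Hara2008_piLeftLimit`),
`LaceExpansionPcLimit.lean` (`Hara2008_prop12Pc_of_subcrit : Hara2008_prop12Subcrit →
Hara2008_piLeftLimit → Hara2008_prop12Pc`, Hara's Appendix A items 1–4 proved along `p ↑ p_c`) and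
`LaceExpansionPcInputs.lean` (`Hara2008_prop12Pc`, and the uniqueness of the coefficient at `p_c`,
`IsLaceCoefficientPc.unique`).

In print, the existence of `Π_{p_c}(x) = lim_{p ↑ p_c} Π_p(x)` is Hara's Lemma A.1 ("`Π^{(n)}_p(x)`
is continuous in `p` for `p < p_c`, and is left-continuous at `p = p_c`"), proved for percolation
in Appendix A.2 by decomposing `Π^{(n)}_p` into increasing/decreasing events — an argument about
the Hara–Slade coefficients themselves, which this library does not construct. Here the named
fact `Hara2008_piLeftLimit` is instead DERIVED from `Hara2008_prop12Subcrit` alone, by an argument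
that only uses what the library already proves:

* **compactness** — by the `p`-independent majorant `|Π_p(x)| ≤ h(x)` of Prop. 1.2 the family
  `(Π_p)_{p < p_c}` lives in the compact metrisable box `Π_x [-h(x), h(x)] ⊆ ℝ^{ℤ^d}` (product
  topology; `ℤ^d` is countable), so every sequence `p_n ↑ p_c` has a subsequence along which
  `Π_{p_n} → Ψ` pointwise (`exists_subseq_tendsto_of_abs_le`);
* **Hara's Appendix A along a sequence** — items 1–4 of Appendix A, exactly as mechanised in
  `LaceExpansionPcLimit.lean` but along an arbitrary sequence `p_n ↑ p_c` instead of the filter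
  `𝓝[<] p_c` (Tannery's theorem for `ĝ_{p_n}`, `Ĵ_{p_n}`; (A.1) `Ĵ_{p_n}(0) → 1`; left-continuity of
  `τ_p`; dominated convergence on the cube with the majorant `const · S(k)^{-1}`), show that every
  such subsequential limit `Ψ` is a lace-expansion coefficient AT `p_c`: `IsLaceCoefficientPc d Ψ`
  (`isLaceCoefficientPc_of_seq`);
* **uniqueness at `p_c`** (`IsLaceCoefficientPc.unique`: two functions representing `τ_{p_c}`
  through `ĝ/(1 - Ĵ)` coincide) — so all subsequential limits agree, and a sequence in a
  sequentially compact set all of whose convergent subsequences have the same limit converges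
  (`Filter.tendsto_of_subseq_tendsto`): `Π_p(x) → Ψ(x)` as `p ↑ p_c` for every `x`
  (`tendsto_nhdsLT_criticalProbI_of_subcrit`);
* **uniqueness below `p_c`** (`IsLaceCoefficientAt.unique`, Heydenreich–van der Hofstad
  Exercise 6.1) transfers this from the family provided by `Hara2008_prop12Subcrit` to every family
  of subcritical coefficients, which is how `Hara2008_piLeftLimit` is quantified.

Consequences: `Hara2008_piLeftLimit_of_subcrit`, and `Hara2008_prop12Pc_of_subcrit'`,
`Hara2008_laceExpansionPc_of_subcrit'` — the `k`-space half `Hara2008_prop12Pc` of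
`Hara2008_laceExpansionPc` now rests on the single named fact `Hara2008_prop12Subcrit` (the
Hara–Slade expansion below `p_c` with `p`-uniform bounds, `d ≥ 11`), and the trust base of
`Hara2008_laceExpansionPc` / `Hara2008_etaZeroXSpace` listed in `LaceExpansionPcAssembly.lean`
shrinks from six printed inputs to five.

## References

* T. Hara, Ann. Probab. 36 (2008) 530–593 (arXiv:math-ph/0504021): Prop. 1.2 ((1.16):
  `0 ≤ Π^{(n)}_p ≤ h^{(n)}`, `Σ_xΣ_n h^{(n)}(x) ≤ c/d`, `h` independent of `p`); Appendix A, items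
  1–4 and (A.1)–(A.2); Lemma A.1 (the printed route to the left limit, not used here).
* M. Heydenreich, R. van der Hofstad, *Progress in High-Dimensional Percolation and Random
  Graphs*, Springer 2017: Exercise 6.1 (uniqueness of `Π̂_p`), Cor. 8.13 and its proof
  ((8.5.4)–(8.5.5): "By dominated convergence, `Π_p(x)` converges to `Π_{p_c}(x)`").
-/

noncomputable section

namespace Literature.Barriers.CriticalPhenomena

open _root_.MeasureTheory _root_.Filter _root_.Topology Literature.Probability.LatticeModels
  Literature.Probability.Percolation Literature.Barriers.CriticalPhenomena.Slade2006Prop53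

open scoped ENNReal

variable {d : ℕ}

/-! ### Dominated convergence for `ĝ`, `Ĵ` along an arbitrary filter -/

section Limit

variable {ι : Type*} {l : Filter ι} {Θ : ι → Site d → ℝ} {s : ι → unitInterval} {q : ℝ}
  {Ψ : Site d → ℝ} {h : Site d → ℝ}

/-- Pointwise convergence of the sources `g_i = δ₀ + Θ_i → δ₀ + Ψ`. [folklore] -/
theorem tendsto_laceSource_apply_of_tendsto
    (hlim : ∀ x, Tendsto (fun i => Θ i x) l (𝓝 (Ψ x))) (x : Site d) :
    Tendsto (fun i => laceSource (Θ i) x) l (𝓝 (laceSource Ψ x)) :=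
  tendsto_const_nhds.add (hlim x)

/-- Pointwise convergence of the kernels `J_i = 2d s_i D ⋆ g_i → 2dq D ⋆ g`. [folklore] -/
theorem tendsto_laceKernel_apply_of_tendsto (hs : Tendsto (fun i => ((s i : unitInterval) : ℝ)) l (𝓝 q))
    (hlim : ∀ x, Tendsto (fun i => Θ i x) l (𝓝 (Ψ x))) (y : Site d) :
    Tendsto (fun i => laceKernel (s i) (Θ i) y) l (𝓝 (laceKernel q Ψ y)) := by
  unfold laceKernel
  refine hs.mul (tendsto_finsetSum _ fun i _ => ?_)
  exact (tendsto_laceSource_apply_of_tendsto hlim _).add (tendsto_laceSource_apply_of_tendsto hlim _)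

/-- **`Ĵ_i(0) = Σ_y J_i(y) → Σ_y J(y)`** along `l` (Tannery's theorem with the `p`-independent
majorant of Prop. 1.2). [cite: Hara2008, Appendix A (items 1–3)] -/
theorem tendsto_tsum_laceKernel_of_tendsto (hh : Summable h)
    (hle : ∀ᶠ i in l, ∀ x, |Θ i x| ≤ h x)
    (hs : Tendsto (fun i => ((s i : unitInterval) : ℝ)) l (𝓝 q))
    (hlim : ∀ x, Tendsto (fun i => Θ i x) l (𝓝 (Ψ x))) :
    Tendsto (fun i => ∑' y, laceKernel (s i) (Θ i) y) l (𝓝 (∑' y, laceKernel q Ψ y)) := by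
  refine tendsto_tsum_of_dominated_convergence (summable_kernelBound hh)
    (tendsto_laceKernel_apply_of_tendsto hs hlim) ?_
  filter_upwards [hle] with i hi y
  rw [Real.norm_eq_abs]
  exact abs_laceKernel_le_of_le hi (s i) y

/-- **`Ĵ_i(k) → Ĵ(k)`** along `l`, for every `k`. [cite: Hara2008, Appendix A (item 3)]
[cite: HeydenreichVanDerHofstad2017, Cor. 8.13 (proof)] -/
theorem tendsto_latticeFT_laceKernel_of_tendsto (hh : Summable h)
    (hle : ∀ᶠ i in l, ∀ x, |Θ i x| ≤ h x)
    (hs : Tendsto (fun i => ((s i : unitInterval) : ℝ)) l (𝓝 q))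
    (hlim : ∀ x, Tendsto (fun i => Θ i x) l (𝓝 (Ψ x))) (k : Fin d → ℝ) :
    Tendsto (fun i => latticeFT (laceKernel (s i) (Θ i)) k) l
      (𝓝 (latticeFT (laceKernel q Ψ) k)) := by
  unfold latticeFT
  refine tendsto_tsum_of_dominated_convergence (summable_kernelBound hh) (fun y => ?_) ?_
  · exact ((Complex.continuous_ofReal.tendsto _).comp
      (tendsto_laceKernel_apply_of_tendsto hs hlim y)).mul tendsto_const_nhds
  · filter_upwards [hle] with i hi y
    rw [norm_latticeFT_term]
    exact abs_laceKernel_le_of_le hi (s i) y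

/-- **`ĝ_i(k) → ĝ(k)`** along `l`, for every `k`. [cite: Hara2008, Appendix A (item 3)]
[cite: HeydenreichVanDerHofstad2017, Cor. 8.13 (proof)] -/
theorem tendsto_latticeFT_laceSource_of_tendsto (hh : Summable h)
    (hle : ∀ᶠ i in l, ∀ x, |Θ i x| ≤ h x)
    (hlim : ∀ x, Tendsto (fun i => Θ i x) l (𝓝 (Ψ x))) (k : Fin d → ℝ) :
    Tendsto (fun i => latticeFT (laceSource (Θ i)) k) l (𝓝 (latticeFT (laceSource Ψ) k)) := by
  unfold latticeFT
  refine tendsto_tsum_of_dominated_convergence (summable_sourceBound hh) (fun y => ?_) ?_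
  · exact ((Complex.continuous_ofReal.tendsto _).comp
      (tendsto_laceSource_apply_of_tendsto hlim y)).mul tendsto_const_nhds
  · filter_upwards [hle] with i hi y
    rw [norm_latticeFT_term]
    exact abs_laceSource_le_of_le hi y

end Limit

/-! ### Hara's Appendix A along a sequence `p_n ↑ p_c` -/

section Subcrit

/-! The hypotheses `hh, hc₁, hp₀, hP, hIR` of this section are the body of `Hara2008_prop12Subcrit`
for one `d`, in the shape `obtain ⟨Φ, h, c₁, C, p₀, hh, hc₁, hp₀, hP, hIR⟩ := hS d hd` delivers. -/

variable {Φ : unitInterval → Site d → ℝ} {h : Site d → ℝ} {c₁ C : ℝ} {p₀ : unitInterval}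

/-- **Appendix A, items 1–4, along a sequence.** If `p_n ↑ p_c` (`p_n < p_c`, `p_n → p_c`) and
the subcritical coefficients converge pointwise along it, `Π_{p_n}(x) → Ψ(x)` for every `x`, then
`Ψ` is a lace-expansion coefficient AT `p_c` (`IsLaceCoefficientPc d Ψ`) with finite second
moment: `Ψ` is symmetric and dominated by `h`; `Σ|x|²|Ψ| ≤ C` by Fatou on finite sums;
`Ĵ_{p_n}(0) → Ĵ(0)` (Tannery) and `Ĵ_{p_n}(0) → 1` ((A.1), `tendsto_tsum_laceKernel_one`) give
`Ĵ(0) = 1`; the infrared lower bound passes to the limit; and `τ_{p_c}(x) = lim τ_{p_n}(x) =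
lim ∫ e^{ikx} ĝ_{p_n}/(1 - Ĵ_{p_n}) dk/(2π)^d = ∫ e^{ikx} ĝ/(1 - Ĵ) dk/(2π)^d` by the
left-continuity of `τ_p` and dominated convergence on the cube ("the integrand is integrable in
`k` uniformly in `p < p_c`, thanks to the infrared bound"). The proof is that of
`Hara2008_prop12Pc_of_subcrit` with the filter `𝓝[<] p_c` replaced by a sequence.
[cite: Hara2008, Appendix A (items 1–4, (A.1)–(A.2))]
[cite: HeydenreichVanDerHofstad2017, Cor. 8.13 (proof, (8.5.4)–(8.5.5))] -/
theorem isLaceCoefficientPc_of_seq (hd : 7 ≤ d) (hh : Summable h) (hc₁ : 0 < c₁)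
    (hp₀ : p₀ < criticalProbI d)
    (hP : ∀ p : unitInterval, p < criticalProbI d →
      IsLaceCoefficientAt d p (Φ p) ∧ (∀ x : Site d, |Φ p x| ≤ h x) ∧
      (Summable fun x : Site d => euclidNorm x ^ 2 * |Φ p x|) ∧
      (∑' x : Site d, euclidNorm x ^ 2 * |Φ p x|) ≤ C)
    (hIR : ∀ p : unitInterval, p₀ ≤ p → p < criticalProbI d →
      ∀ k ∈ cube d, c₁ * (∑ i, k i ^ 2) / d ≤
        (∑' y, laceKernel p (Φ p) y) - (latticeFT (laceKernel p (Φ p)) k).re)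
    {s : ℕ → unitInterval} (hs : Tendsto s atTop (𝓝[<] criticalProbI d)) {Ψ : Site d → ℝ}
    (hΨ : ∀ x, Tendsto (fun n => Φ (s n) x) atTop (𝓝 (Ψ x))) :
    IsLaceCoefficientPc d Ψ ∧ Summable fun x => euclidNorm x ^ 2 * |Ψ x| := by
  have hd2 : 2 ≤ d := by omega
  have hd1 : 1 ≤ d := by omega
  have hd' : (0 : ℝ) < d := by exact_mod_cast (show 0 < d by omega)
  set pc := criticalProbI d with hpc_def
  have hAt : ∀ p, p < pc → IsLaceCoefficientAt d p (Φ p) := fun p hp => (hP p hp).1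
  have hle : ∀ p, p < pc → ∀ x, |Φ p x| ≤ h x := fun p hp => (hP p hp).2.1
  have hmom : ∀ p, p < pc → Summable fun x => euclidNorm x ^ 2 * |Φ p x| :=
    fun p hp => (hP p hp).2.2.1
  have hmomC : ∀ p, p < pc → ∑' x, euclidNorm x ^ 2 * |Φ p x| ≤ C :=
    fun p hp => (hP p hp).2.2.2
  -- eventually `p_n < p_c`, indeed `p_n ∈ [p₀, p_c)`
  have hev : ∀ᶠ n in atTop, s n < pc := hs.eventually eventually_mem_nhdsWithin
  have hev' : ∀ᶠ n in atTop, p₀ ≤ s n ∧ s n < pc := by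
    filter_upwards [hs.eventually (Ico_mem_nhdsLT hp₀)] with n hn
    exact ⟨hn.1, hn.2⟩
  have hleev : ∀ᶠ n in atTop, ∀ x, |Φ (s n) x| ≤ h x := hev.mono fun n hn => hle _ hn
  have hcoe : Tendsto (fun n => ((s n : unitInterval) : ℝ)) atTop (𝓝 (pc : ℝ)) :=
    tendsto_coe_nhdsLT_criticalProbI.comp hs
  -- (1) symmetry
  have hsymm : IsZdSymmetric Ψ := by
    intro π ε x
    have h2 : (fun n => Φ (s n) x) =ᶠ[atTop] fun n => Φ (s n) (Site.signedPerm π ε x) :=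
      hev.mono fun n hn => ((hAt _ hn).symm π ε x).symm
    exact tendsto_nhds_unique ((hΨ x).congr' h2) (hΨ _) |>.symm
  -- (2) domination and summability
  have hΨle : ∀ x, |Ψ x| ≤ h x := fun x =>
    le_of_tendsto ((continuous_abs.tendsto _).comp (hΨ x)) (hev.mono fun n hn => hle _ hn x)
  have hΨabs : Summable fun x => |Ψ x| :=
    Summable.of_nonneg_of_le (fun _ => abs_nonneg _) hΨle hh
  -- (3) the second moment, by Fatou on finite sums
  have hΨmom : Summable fun x => euclidNorm x ^ 2 * |Ψ x| := by
    refine summable_of_sum_le (fun x => by positivity) (c := C) fun F => ?_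
    have hT : Tendsto (fun n => ∑ x ∈ F, euclidNorm x ^ 2 * |Φ (s n) x|) atTop
        (𝓝 (∑ x ∈ F, euclidNorm x ^ 2 * |Ψ x|)) :=
      tendsto_finsetSum F fun x _ => ((continuous_abs.tendsto _).comp (hΨ x)).const_mul _
    refine le_of_tendsto hT (hev.mono fun n hn => ?_)
    exact (Summable.sum_le_tsum F (fun x _ => by positivity) (hmom _ hn)).trans (hmomC _ hn)
  -- (4) `Ĵ_{p_c}(0) = 1`
  have hJlim := tendsto_tsum_laceKernel_of_tendsto hh hleev hcoe hΨ
  have hJone : Tendsto (fun n => ∑' y, laceKernel (s n) (Φ (s n)) y) atTop (𝓝 1) :=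
    (tendsto_tsum_laceKernel_one hd2 hh hAt hle).comp hs
  have hsumJ : ∑' y, laceKernel pc Ψ y = 1 := tendsto_nhds_unique hJlim hJone
  have hJsum : Summable (laceKernel pc Ψ) :=
    summable_abs_iff.1 (summable_abs_laceKernel hΨabs _)
  have hHasSum : HasSum (laceKernel pc Ψ) 1 := hsumJ ▸ hJsum.hasSum
  -- (5) the infrared lower bound at `p_c`
  have hlowc : ∀ k ∈ cube d, c₁ * (∑ i, k i ^ 2) / d ≤ 1 - (latticeFT (laceKernel pc Ψ) k).re := by
    intro k hk
    have hT : Tendsto (fun n =>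
        (∑' y, laceKernel (s n) (Φ (s n)) y) - (latticeFT (laceKernel (s n) (Φ (s n))) k).re) atTop
        (𝓝 (1 - (latticeFT (laceKernel pc Ψ) k).re)) :=
      hJone.sub ((Complex.continuous_re.tendsto _).comp
        (tendsto_latticeFT_laceKernel_of_tendsto hh hleev hcoe hΨ k))
    exact ge_of_tendsto hT (hev'.mono fun n hn => hIR _ hn.1 hn.2 k hk)
  have hden : ∀ k ∈ cube d, k ≠ 0 → (1 : ℂ) - latticeFT (laceKernel pc Ψ) k ≠ 0 := by
    intro k hk hk0
    have hS : 0 < ∑ i, k i ^ 2 := by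
      obtain ⟨j, hj⟩ : ∃ j, k j ≠ 0 := by
        by_contra hne'
        push Not at hne'
        exact hk0 (funext hne')
      exact lt_of_lt_of_le (by positivity) (Finset.single_le_sum (fun i _ => sq_nonneg (k i))
        (Finset.mem_univ j))
    have hpos : 0 < 1 - (latticeFT (laceKernel pc Ψ) k).re :=
      lt_of_lt_of_le (by positivity) (hlowc k hk)
    intro hz
    have := congrArg Complex.re hz
    simp only [Complex.sub_re, Complex.one_re, Complex.zero_re] at this
    linarith
  -- (6) the representation at `p_c`, by dominated convergence on the cube
  have hrepr : ∀ x : Site d,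
      ((tau d pc 0 x : ℝ) : ℂ) = haraH (laceKernel pc Ψ) (laceSource Ψ) x := by
    intro x
    set F : ℕ → (Fin d → ℝ) → ℂ := fun n k =>
      haraIntegrand (laceKernel (s n) (Φ (s n))) (laceSource (Φ (s n))) x k with hFdef
    set Fc : (Fin d → ℝ) → ℂ := fun k =>
      haraIntegrand (laceKernel pc Ψ) (laceSource Ψ) x k with hFc
    set B : ℝ := ∑' z : Site d, ((if z = 0 then (1 : ℝ) else 0) + h z) with hB
    set bound : (Fin d → ℝ) → ℝ := fun k => B * d / (c₁ * 2) * (S d k)⁻¹ with hbound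
    have hPd : (volume.restrict (cube d) : Measure (Fin d → ℝ)) = P d := volume_restrict_cube d
    have hae : ∀ᵐ k ∂P d, k ∈ cube d ∧ k ≠ 0 := by
      have h1 : ∀ᵐ k ∂P d, k ∈ cube d := by
        rw [← hPd]; exact ae_restrict_mem (measurableSet_cube d)
      have h2 : ∀ᵐ k ∂P d, k ∈ ({0} : Set (Fin d → ℝ))ᶜ :=
        compl_mem_ae_iff.2 (P_singleton_zero hd1)
      filter_upwards [h1, h2] with k hk hk0
      exact ⟨hk, hk0⟩
    -- measurability (for `p_n < p_c`, `F n` is a.e. the continuous function `e^{ikx} τ̂_{p_n}(k)`)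
    have hmeas : ∀ᶠ n in atTop, AEStronglyMeasurable (F n) (P d) := by
      refine hev'.mono fun n hn => ?_
      have hcont : Continuous fun k =>
          Complex.exp (Complex.I * (kdot k x : ℂ)) * latticeFT (tau d (s n) 0) k :=
        (continuous_cexp_I_mul_kdot x).mul (continuous_latticeFT (summable_abs_tau_of_lt hd2 hn.2))
      refine hcont.aestronglyMeasurable.congr ?_
      filter_upwards [hae] with k hk
      simp only [hFdef, haraIntegrand]
      rw [(hAt _ hn.2).latticeFT_tau_eq_div hd2 hn.2
        ((hAt _ hn.2).one_sub_latticeFT_ne_zero hd2 hn.2 hc₁ (hIR _ hn.1 hn.2 k hk.1))]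
    -- domination by `bound`
    have hdom : ∀ᶠ n in atTop, ∀ᵐ k ∂P d, ‖F n k‖ ≤ bound k := by
      refine hev'.mono fun n hn => ?_
      filter_upwards [hae] with k hk
      have hBp : ∑' z, |laceSource (Φ (s n)) z| ≤ B :=
        Summable.tsum_le_tsum (abs_laceSource_le_of_le (hle _ hn.2))
          (summable_abs_laceSource (hAt _ hn.2).summable_abs) (summable_sourceBound hh)
      have h1 := (hAt _ hn.2).norm_ratio_le hd2 hn.2 hc₁ (hIR _ hn.1 hn.2 k hk.1) hk.2 hBp
      have hSpos := S_pos_of_ne_zero hk.1 hk.2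
      have h2S := two_mul_S_le_sum_sq k
      have hB0 : 0 ≤ B := le_trans (tsum_nonneg fun _ => abs_nonneg _) hBp
      simp only [hFdef, haraIntegrand, norm_mul, norm_cexp_I_mul_kdot, one_mul]
      refine h1.trans ?_
      have e : bound k = B * d / (c₁ * (2 * S d k)) := by
        rw [hbound]
        field_simp
      rw [e]
      exact div_le_div_of_nonneg_left (by positivity) (by positivity) (by nlinarith)
    have hbi : Integrable bound (P d) := (integrable_inv_S hd).const_mul _
    -- pointwise limit
    have hlimF : ∀ᵐ k ∂P d, Tendsto (fun n => F n k) atTop (𝓝 (Fc k)) := by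
      filter_upwards [hae] with k hk
      simp only [hFdef, hFc, haraIntegrand]
      exact tendsto_const_nhds.mul ((tendsto_latticeFT_laceSource_of_tendsto hh hleev hΨ k).div
        (tendsto_const_nhds.sub (tendsto_latticeFT_laceKernel_of_tendsto hh hleev hcoe hΨ k))
        (hden k hk.1 hk.2))
    have hDCT := tendsto_integral_filter_of_dominated_convergence bound hmeas hdom hbi hlimF
    -- the integrals below `p_c` are `(2π)^d τ_{p_n}(x)`, which converge to `(2π)^d τ_{p_c}(x)`
    have hFint : ∀ᶠ n in atTop,
        ((2 * Real.pi) ^ d : ℂ) * ((tau d (s n) 0 x : ℝ) : ℂ) = ∫ k, F n k ∂P d :=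
      hev'.mono fun n hn => by
        rw [← hPd]
        exact ((hAt _ hn.2).integral_haraIntegrand_eq hd2 hn.2 hc₁ (hIR _ hn.1 hn.2) x).symm
    have hτlim : Tendsto (fun n => ((2 * Real.pi) ^ d : ℂ) * ((tau d (s n) 0 x : ℝ) : ℂ))
        atTop (𝓝 (((2 * Real.pi) ^ d : ℂ) * ((tau d pc 0 x : ℝ) : ℂ))) :=
      tendsto_const_nhds.mul ((Complex.continuous_ofReal.tendsto _).comp
        ((tendsto_tau_nhdsLT_criticalProbI x).comp hs))
    have heq : ∫ k, Fc k ∂P d = ((2 * Real.pi) ^ d : ℂ) * ((tau d pc 0 x : ℝ) : ℂ) :=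
      tendsto_nhds_unique hDCT (hτlim.congr' hFint)
    have hc : ((2 * Real.pi : ℂ)) ^ d ≠ 0 :=
      pow_ne_zero _ (mul_ne_zero two_ne_zero (Complex.ofReal_ne_zero.2 Real.pi_ne_zero))
    unfold haraH
    rw [hPd]
    change _ = (∫ k, Fc k ∂P d) / _
    rw [heq, mul_div_cancel_left₀ _ hc]
  exact ⟨⟨hsymm, hΨabs, hHasSum, ⟨c₁, hc₁, hlowc⟩, hrepr⟩, hΨmom⟩

/-! ### Compactness: subsequential limits exist -/

/-- **Compactness of the dominated family.** Along every sequence `p_n ↑ p_c` a subsequence of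
`(Π_{p_n})` converges pointwise: the `Π_p`, `p < p_c`, lie in the box `Π_x [-h(x), h(x)]`, compact
in the product topology of `ℝ^{ℤ^d}` (Tychonoff) and first countable (`ℤ^d` is countable), hence
sequentially compact. [folklore] -/
theorem exists_subseq_tendsto_of_abs_le
    (hle : ∀ p : unitInterval, p < criticalProbI d → ∀ x : Site d, |Φ p x| ≤ h x)
    {s : ℕ → unitInterval} (hs : Tendsto s atTop (𝓝[<] criticalProbI d)) :
    ∃ (Ψ : Site d → ℝ) (φ : ℕ → ℕ), StrictMono φ ∧
      ∀ x, Tendsto (fun n => Φ (s (φ n)) x) atTop (𝓝 (Ψ x)) := by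
  set K : Set (Site d → ℝ) := Set.pi Set.univ fun y => Set.Icc (-h y) (h y) with hK_def
  have hK : IsCompact K := isCompact_univ_pi fun y => isCompact_Icc
  have hmem : ∃ᶠ n in atTop, (fun n => Φ (s n)) n ∈ K := by
    refine Eventually.frequently ?_
    filter_upwards [hs.eventually eventually_mem_nhdsWithin] with n hn
    exact fun y _ => abs_le.1 (hle _ hn y)
  obtain ⟨Ψ, -, φ, hφ, hT⟩ := hK.tendsto_subseq' hmem
  exact ⟨Ψ, φ, hφ, fun x => tendsto_pi_nhds.1 hT x⟩

/-! ### Existence and uniqueness of the limit: the left limit of `Π_p` at `p_c` -/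

/-- **A lace-expansion coefficient at `p_c` exists**, as a subsequential limit of the subcritical
ones (`d ≥ 7` suffices for the argument; the fact is used for `d ≥ 11`).
[cite: Hara2008, Appendix A (items 1–4)] -/
theorem exists_isLaceCoefficientPc_of_subcrit (hd : 7 ≤ d) (hh : Summable h) (hc₁ : 0 < c₁)
    (hp₀ : p₀ < criticalProbI d)
    (hP : ∀ p : unitInterval, p < criticalProbI d →
      IsLaceCoefficientAt d p (Φ p) ∧ (∀ x : Site d, |Φ p x| ≤ h x) ∧
      (Summable fun x : Site d => euclidNorm x ^ 2 * |Φ p x|) ∧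
      (∑' x : Site d, euclidNorm x ^ 2 * |Φ p x|) ≤ C)
    (hIR : ∀ p : unitInterval, p₀ ≤ p → p < criticalProbI d →
      ∀ k ∈ cube d, c₁ * (∑ i, k i ^ 2) / d ≤
        (∑' y, laceKernel p (Φ p) y) - (latticeFT (laceKernel p (Φ p)) k).re) :
    ∃ Ψ : Site d → ℝ, IsLaceCoefficientPc d Ψ ∧ Summable fun x => euclidNorm x ^ 2 * |Ψ x| := by
  haveI : (𝓝[<] criticalProbI d).NeBot := nhdsLT_neBot_of_exists_lt ⟨p₀, hp₀⟩
  obtain ⟨s, hs⟩ := exists_seq_tendsto (𝓝[<] criticalProbI d)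
  obtain ⟨Ψ, φ, hφ, hΨ⟩ := exists_subseq_tendsto_of_abs_le (fun p hp => (hP p hp).2.1) hs
  exact ⟨Ψ, isLaceCoefficientPc_of_seq hd hh hc₁ hp₀ hP hIR (hs.comp hφ.tendsto_atTop) hΨ⟩

/-- **The left limit of `Π_p(x)` at `p_c` exists and is the coefficient at `p_c`**: for the
(unique) `Ψ` with `IsLaceCoefficientPc d Ψ`, `Π_p(x) → Ψ(x)` as `p ↑ p_c`, for every `x` — every
sequence `p_n ↑ p_c` has a subsequence along which `Π_{p_n} → Ψ'` pointwise (compactness), `Ψ'`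
is a coefficient at `p_c` (Appendix A along the subsequence), and `Ψ' = Ψ` by uniqueness at `p_c`
(`IsLaceCoefficientPc.unique`); a sequence all of whose subsequences have a further subsequence
converging to `Ψ(x)` converges to `Ψ(x)`. This replaces Hara's Lemma A.1.
[cite: Hara2008, Appendix A (item 3 and Lemma A.1)]
[cite: HeydenreichVanDerHofstad2017, Cor. 8.13 (proof: "Π_p(x) converges to Π_{p_c}(x) for fixed x as p ↗ p_c")] -/
theorem tendsto_nhdsLT_criticalProbI_of_subcrit (hd : 7 ≤ d) (hh : Summable h) (hc₁ : 0 < c₁)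
    (hp₀ : p₀ < criticalProbI d)
    (hP : ∀ p : unitInterval, p < criticalProbI d →
      IsLaceCoefficientAt d p (Φ p) ∧ (∀ x : Site d, |Φ p x| ≤ h x) ∧
      (Summable fun x : Site d => euclidNorm x ^ 2 * |Φ p x|) ∧
      (∑' x : Site d, euclidNorm x ^ 2 * |Φ p x|) ≤ C)
    (hIR : ∀ p : unitInterval, p₀ ≤ p → p < criticalProbI d →
      ∀ k ∈ cube d, c₁ * (∑ i, k i ^ 2) / d ≤
        (∑' y, laceKernel p (Φ p) y) - (latticeFT (laceKernel p (Φ p)) k).re)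
    {Ψ : Site d → ℝ} (hΨ : IsLaceCoefficientPc d Ψ) (x : Site d) :
    Tendsto (fun p : unitInterval => Φ p x) (𝓝[<] criticalProbI d) (𝓝 (Ψ x)) := by
  refine tendsto_of_subseq_tendsto fun s hs => ?_
  obtain ⟨Ψ', φ, hφ, hΨ'⟩ := exists_subseq_tendsto_of_abs_le (fun p hp => (hP p hp).2.1) hs
  have h1 := (isLaceCoefficientPc_of_seq hd hh hc₁ hp₀ hP hIR (hs.comp hφ.tendsto_atTop) hΨ').1
  have heq : Ψ' = Ψ := h1.unique (by omega) hΨ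
  exact ⟨φ, heq ▸ hΨ' x⟩

/-- The limit of `tendsto_nhdsLT_criticalProbI_of_subcrit` packaged as in `Hara2008_piLeftLimit`.
[cite: Hara2008, Appendix A (item 3 and Lemma A.1)] -/
theorem exists_tendsto_nhdsLT_criticalProbI_of_subcrit (hd : 7 ≤ d) (hh : Summable h) (hc₁ : 0 < c₁)
    (hp₀ : p₀ < criticalProbI d)
    (hP : ∀ p : unitInterval, p < criticalProbI d →
      IsLaceCoefficientAt d p (Φ p) ∧ (∀ x : Site d, |Φ p x| ≤ h x) ∧
      (Summable fun x : Site d => euclidNorm x ^ 2 * |Φ p x|) ∧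
      (∑' x : Site d, euclidNorm x ^ 2 * |Φ p x|) ≤ C)
    (hIR : ∀ p : unitInterval, p₀ ≤ p → p < criticalProbI d →
      ∀ k ∈ cube d, c₁ * (∑ i, k i ^ 2) / d ≤
        (∑' y, laceKernel p (Φ p) y) - (latticeFT (laceKernel p (Φ p)) k).re) (x : Site d) :
    ∃ L : ℝ, Tendsto (fun p : unitInterval => Φ p x) (𝓝[<] criticalProbI d) (𝓝 L) := by
  obtain ⟨Ψ, hΨ, -⟩ := exists_isLaceCoefficientPc_of_subcrit hd hh hc₁ hp₀ hP hIR
  exact ⟨Ψ x, tendsto_nhdsLT_criticalProbI_of_subcrit hd hh hc₁ hp₀ hP hIR hΨ x⟩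

end Subcrit

/-! ### The named fact `Hara2008_piLeftLimit`, and `Hara2008_prop12Pc` from the subcritical expansion alone -/

/-- **`Hara2008_piLeftLimit` from `Hara2008_prop12Subcrit`.** For `d ≥ 11` and ANY family
`(Φ_p)_{p < p_c}` of subcritical lace-expansion coefficients, `lim_{p ↑ p_c} Φ_p(x)` exists for
every `x`: by uniqueness below `p_c` (`IsLaceCoefficientAt.unique`) the family agrees on
`[0, p_c)` with the one provided by `Hara2008_prop12Subcrit`, whose left limit exists by
`tendsto_nhdsLT_criticalProbI_of_subcrit` (compactness and uniqueness at `p_c`, in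
place of Hara's Lemma A.1). [cite: Hara2008, Appendix A (item 3 and Lemma A.1)]
[cite: HeydenreichVanDerHofstad2017, Exercise 6.1 and Cor. 8.13 (proof)] -/
theorem Hara2008_piLeftLimit_of_subcrit (hS : Hara2008_prop12Subcrit) : Hara2008_piLeftLimit := by
  intro d hd Φ₁ hAt₁ x
  obtain ⟨Φ, h, c₁, C, p₀, hh, hc₁, hp₀, hP, hIR⟩ := hS d hd
  obtain ⟨L, hL⟩ := exists_tendsto_nhdsLT_criticalProbI_of_subcrit (by omega) hh hc₁ hp₀ hP hIR x
  refine ⟨L, hL.congr' ?_⟩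
  filter_upwards [eventually_mem_nhdsWithin] with p hp
  exact congrFun (IsLaceCoefficientAt.unique (by omega) hp (hP p hp).1 (hAt₁ p hp)) x

/-- **`Hara2008_prop12Pc` from the subcritical lace expansion alone**: Hara's Prop. 1.2 at
`p = p_c` for percolation, `d ≥ 11`, follows from the expansion below `p_c` with `p`-uniform
bounds (`Hara2008_prop12Subcrit`) — Appendix A, with Lemma A.1 replaced by compactness and the
uniqueness of the coefficient at `p_c`. [cite: Hara2008, Prop. 1.2 and Appendix A] -/
theorem Hara2008_prop12Pc_of_subcrit' (hS : Hara2008_prop12Subcrit) : Hara2008_prop12Pc :=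
  Hara2008_prop12Pc_of_subcrit hS (Hara2008_piLeftLimit_of_subcrit hS)

/-- **`Hara2008_laceExpansionPc` from the subcritical expansion and the `x`-space half.**
[cite: Hara2008, §1.2.1 and Appendix A] -/
theorem Hara2008_laceExpansionPc_of_subcrit' (hS : Hara2008_prop12Subcrit)
    (hX : Hara2008_xSpacePiBoundPc) : Hara2008_laceExpansionPc :=
  Hara2008_laceExpansionPc_of_inputs (Hara2008_prop12Pc_of_subcrit' hS) hX

end Literature.Barriers.CriticalPhenomena
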